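import Summits.QuantumFields.YangMills.Theorems.UnitScaleTiltProp7KatoBootstrapMember
import Literature.MathematicalPhysics.QuantumFieldTheory.Balaban1983to89.B9Eq343CovariantResolventHolderAdjointRow
import Literature.MathematicalPhysics.QuantumFieldTheory.Balaban1983to89.B9Eq342CovariantResolventAdjointRow
import HarnessLib

/-!
# Route `UnitScaleTilt`, crux K1 «MinimiserStabilityRegPr» (stmt-QuantumFields-19200), EX row (5) `norm_G`, STOREY H, H-road brick **H2 FILE 1 — THE η-½-HÖLDER ROW OF THE
# COVARIANT MASSIVE RESOLVENT OF A DIVERGENCE, `w := (Δ^η_V + m)⁻¹ D*_V f`, AT THE T³ MEMBER, IN A REGULAR GAUGE** = lit ✓`B9Eq343CovariantResolventHolderAdjointRow.holderAdjRow_covariantResolvent_half`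
# ([Balaban1985BackgroundPropagators] Thm 3.1 (3.43), second member) INSTANTIATED at the member's carriers (`d := 3`, `P := periodsT3 F K`, `W := W₂`, `t := η⁻¹`, `R := adBg F K V`,
# `S := adBgInv F K V`, `β := ½`, window `ℓ := L^(K−n)`), the transporter letters discharged (✓`adBgInv_adBg`, ✓`norm_adBg_eq`, ✓`norm_adBgInv_eq`), the regular-gauge rows, the flat
# two-point letter `Hflat` and the gradient letter `Hgrad` DISPLAYED — OWNER RULING №48 letter (A) (plain differences) for the word `w` (19200 evidence `LOCATE-H2-HolderRow-px19g15.md`)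

Cell `ym3-torus` (HUMAN RULING D-0037; rung R3 = SU(2) YM₃ on T³ — NOT d = 4, NOT infinite volume, NOT a mass gap, NOT Clay).  Width seat `ym3-torus-px19` (gen 15); chair WORD №46 (H2).
THEOREMS ONLY (0 `def`, 0 `sorry`, default heartbeats); `--supports stmt-QuantumFields-19200 --as helper`; count-neutral.

THE MATHEMATICS.  Nothing new: the member's weighted `L²` carriers ARE lit's generic ones (✓`Prop7SectET3HilbertLetters.covLapSite_eq` is `rfl`; `DL2`∕`DstarL2` are `covDerivL2K`∕`covDivL2K`
at `t = η⁻¹` with the transporters `adBg`∕`adBgInv`), so print's affine Hölder bootstrap — `G_mD*_Sf = z − G_mD*_Sq − G_ms + G_m(D*_S − D*_1)f`, flat letter for `z`, VALUE data only in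
the perturbation — applies verbatim.  The three displayed classes are exactly lit's: the REGULAR-GAUGE rows of `V` (`‖Ad V(b) − 1‖ ≤ ε`, adjacent transporters `ε′` — print's Thm 2
gauge, the EX display's `hThm2S`; NOT a `RegPr` consequence), the FLAT two-point Hölder letter `Hflat` on `TSite 3 (periodsT3 F K)` (lit: «NOT in the tree on the chain's carrier»; the
local unweighted core is ✓`Prop7FlatMemberLocalGradient.exists_localHolder_flat_member`), and the gradient letter `Hgrad` of `(Δ^η_V+m)⁻¹` on weighted value data (✓`exists_curved_localGradient`
∘ ✓`gradient_absorption` pattern).  `ω₁ = R_S G′ᴾ_a D*_V x` follows in FILE 2 by the second resolvent identity and the `R_S` knit (LOCATE §2).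

WHAT IS PROVED (ns `Summit.QuantumFields.YangMills.Theorems.Prop7ResolventHolderRowMember`; member `F n K`, weight `c₀ > 0`, background `V` in a given gauge).
* §1 `two_le_periodsT3` (`2 ≤ 2L^{m+K}`), `adBgInv_adBg'`, `norm_adBg_le`, `norm_adBgInv_le` (the transporter letters in lit's binder shape).
* §2 ★★★ `holderRow_resolventCovDiv_member` — for `tdist y y′ ≤ L^(K−n)`:
  `‖(G_mD*_Vf)(y′) − (G_mD*_Vf)(y)‖ ≤ 2A_H·F·(tdist y y′∕L^(K−n))^{½}·W_{x₀}(y)` whenever `‖f(b)‖ ≤ F·W_{x₀}(b₋)`, `A_H` lit's explicit constant at `d = 3`, `t = η⁻¹`, `β = ½`;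
  ★★ `valueRow_resolventCovDiv_member` — the companion VALUE row (lit ✓`B9Eq342CovariantResolventAdjointRow.adjRow_covariantResolvent_half`, (3.42); no flat∕gradient letter displayed).
* §3 `covLapSite_add_pos` (lit's `hpos` DISCHARGED: `Δ^η_V + m > 0`), `covLapSite_add_eq`, `DstarL2_eq_covDivL2K`, `DL2_eq_covDerivL2K` (the `Complex.ofReal_inv` bridges), ★★★
  `holderRow_resolventDstarL2_member` — §2 in MEMBER NOTATION (`Tm := covLapSite V + m`, `DstarL2`, `DL2` in `Hgrad`): the statement FILE 2 consumes.
* §4 `plainModulus_ball_of_window` — letter (A) on the window `ℓ` + the sup row ⟹ the plain modulus for all pairs on any ball (the `hH` premise of px13's ⧗`Prop7AxialHolderLetterGlue`, constant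
  `H_A + 2N_ω`), and `hH_of_window_of_sup` — px13's `hH` text VERBATIM with `H := Hω + 2·Nω` (★★OWNER ruling 15:45Z).
HYP-SAT (★★OWNER RULING №42).  Displayed: `hRε hSε hSε'` (inhabited at the Thm-2 regular representative, and trivially at `V = 1` with `ε = ε′ = 0`), `Wt∕Sad∕Tm` pinned by equations (any
`a ≥ 0` with `6η⁻²(cosh a − 1) < m`; `a = 0` always), `hpos` (true for every `m > 0` by ✓`inner_covLapSite`; kept displayed in lit's shape), `Hflat`∕`Hgrad` (real inequalities between
finite suprema at fixed data — inhabited by large constants; K-free content is the port named above), `hκ` (an `ε`-window).  Conclusion: an explicit real inequality; nothing assumed is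
conclusion-shaped.
HONEST SCOPE.  Instantiation∕plumbing only; `Hflat`, `Hgrad`, the regular-gauge rows are NOT proved here; nothing of `ω₁`'s row (FILE 2), `h3`, norm_G, EX, 19200 or R3 is proved; the
Yang–Mills mass gap is NOT proved.

References: T. Bałaban, CMP **99** (1985) 389–434 [Balaban1985BackgroundPropagators] (Thm 3.1 (3.43) p.398, (3.40) p.397, (3.23) p.394, (3.35) p.396); CMP **96** (1984) 223–250
[Balaban1984PropagatorsII] ((1.9) p.226).
-/

set_option autoImplicit false

noncomputable section

open scoped InnerProductSpace ComplexConjugate BigOperators Matrix.Norms.L2Operator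

namespace Summit.QuantumFields.YangMills.Theorems.Prop7ResolventHolderRowMember

open Literature.MathematicalPhysics.QuantumFieldTheory.Balaban1983to89
open Literature.MathematicalPhysics.QuantumFieldTheory.Balaban1983to89.T3ContinuumYM3Torus
open B4Sect5Torus (TSite tdist tdist_nonneg)
open B4TorusKernel.MultiPeriod (circAbs)
open B9SectCLatticeCarrier (Bond bpos unshift)
open B9Eq311L2Pairing (WL2)
open B11Eq103H1Complex (SiteL2K BondL2K covDerivL2K covDivL2K covLaplaceSiteK greenK)
open T3SectALandauChart (eta eta_pos)
open B9Eq343CovariantResolventHolderAdjointRow (holderAdjRow_covariantResolvent_half)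
open B9Eq342CovariantResolventAdjointRow (adjRow_covariantResolvent_half)
open Summit.QuantumFields.YangMills.Theorems.Prop7SectET3Transport (periodsT3 siteEquiv)
open Summit.QuantumFields.YangMills.Theorems.Prop7SectET3HilbertLetters (W₂ adBg adBgInv DL2 DstarL2 covLapSite covLapSite_eq inner_covLapSite)
open Summit.QuantumFields.YangMills.Theorems.Prop7KatoBootstrapMember (norm_adBg_eq norm_adBgInv_eq adBgInv_adBg)

/-! ## §1 The transporter letters in lit's binder shape -/

section Letters

variable (F : T3Family) (K : ℕ)

/-- `2 ≤ periodsT3 F K ν = 2·L^{m+K}`. [cite: Balaban1985UV3, (1)-(3) p.256] -/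
theorem two_le_periodsT3 (ν : Fin 3) : 2 ≤ periodsT3 F K ν := by
  have h : periodsT3 F K ν = 2 * F.L ^ (F.m + K) := by show 2 * (F.P K).L ^ ((F.P K).m + (F.P K).K - 0) = 2 * F.L ^ (F.m + K); rfl
  have hL : 1 ≤ F.L ^ (F.m + K) := Nat.one_le_pow _ _ (by have := F.hL.2; omega)
  omega

variable {F K}

/-- `Ad(V(b)⁻¹)·Ad(V(b)) = 1` (lit's `hSR`). [cite: Balaban1985BackgroundPropagators, (3.5) p.391] -/
theorem adBgInv_adBg' (V : GaugeField (F.P K) 0 (Matrix.specialUnitaryGroup (Fin 2) ℂ)) : ∀ (b : Bond 3 (periodsT3 F K)) (w : W₂), adBgInv F K V b (adBg F K V b w) = w :=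
  fun b w => adBgInv_adBg F K V b w

/-- `‖Ad(V(b))w‖ ≤ ‖w‖` (lit's `hRn`; an isometry). [cite: Balaban1985BackgroundPropagators, (3.3) p.391] -/
theorem norm_adBg_le (V : GaugeField (F.P K) 0 (Matrix.specialUnitaryGroup (Fin 2) ℂ)) : ∀ (b : Bond 3 (periodsT3 F K)) (w : W₂), ‖adBg F K V b w‖ ≤ ‖w‖ :=
  fun b w => (norm_adBg_eq F K V b w).le

/-- `‖Ad(V(b)⁻¹)w‖ ≤ ‖w‖` (lit's `hSn`). [cite: Balaban1985BackgroundPropagators, (3.8) p.392] -/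
theorem norm_adBgInv_le (V : GaugeField (F.P K) 0 (Matrix.specialUnitaryGroup (Fin 2) ℂ)) : ∀ (b : Bond 3 (periodsT3 F K)) (w : W₂), ‖adBgInv F K V b w‖ ≤ ‖w‖ :=
  fun b w => (norm_adBgInv_eq F K V b w).le

end Letters

/-! ## §2 The Hölder row of `(Δ^η_V + m)⁻¹D*_V` at the member -/

section Row

variable (F : T3Family) (n K : ℕ) (c₀ : ℝ) [Fact (0 < c₀)]

/-- ★★★ **THE η-½-HÖLDER ROW OF `w = (Δ^η_V + m)⁻¹D*_Vf` AT THE T³ MEMBER IN A REGULAR GAUGE** — lit ✓`holderAdjRow_covariantResolvent_half` at `d = 3`, `P = periodsT3 F K`, `W = W₂`,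
`t = η⁻¹` (`η = eta F n K`), `R = adBg F K V`, `S = adBgInv F K V`, `β = ½`, window `ℓ = L^(K−n)`; displayed: the regular-gauge rows `hRε hSε hSε'` of `V`, the weight `Wt` and the
constant `Sad` (pinned by equations), the massive operator `Tm = Δ^η_V + m` with its positivity, the flat two-point letter `Hflat` (constant `SH`) and the gradient letter `Hgrad`
(constant `Θg`), and the contraction window `hκ`.  Conclusion (plain differences, letter (A)): for value data `‖f(b)‖ ≤ F·W_{x₀}(b₋)` and `tdist y y′ ≤ L^(K−n)`,
`‖w(y′) − w(y)‖ ≤ 2A_H·F·(tdist y y′∕L^(K−n))^{½}·W_{x₀}(y)`. [cite: Balaban1985BackgroundPropagators, Thm 3.1 (3.43) p.398, (3.40) p.397, (3.23) p.394, (3.35) p.396] -/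
theorem holderRow_resolventCovDiv_member (V : GaugeField (F.P K) 0 (Matrix.specialUnitaryGroup (Fin 2) ℂ))
    {m a ε ε' : ℝ} (hm : 0 < m) (ha : 0 ≤ a) (hε : 0 ≤ ε) (hε' : 0 ≤ ε')
    (hlam : 2 * ((3 : ℕ) : ℝ) * (eta F n K)⁻¹ ^ 2 * (Real.cosh a - 1) < m)
    (hRε : ∀ (b : Bond 3 (periodsT3 F K)) (w : W₂), ‖adBg F K V b w - w‖ ≤ ε * ‖w‖)
    (hSε : ∀ (b : Bond 3 (periodsT3 F K)) (w : W₂), ‖adBgInv F K V b w - w‖ ≤ ε * ‖w‖)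
    (hSε' : ∀ (x : TSite 3 (periodsT3 F K)) (μ : Fin 3) (w : W₂), ‖adBgInv F K V (x, μ) w - adBgInv F K V (unshift μ x, μ) w‖ ≤ ε' * ‖w‖)
    (Wt : TSite 3 (periodsT3 F K) → TSite 3 (periodsT3 F K) → ℝ)
    (hWt : ∀ x₀ y, Wt x₀ y = ∏ μ, Real.cosh (a * (circAbs (periodsT3 F K μ) ((((x₀ μ : ℕ) : ZMod (periodsT3 F K μ)) - ((y μ : ℕ) : ZMod (periodsT3 F K μ))).val) : ℝ)))
    (Sad : ℝ)
    (hSad : Sad = (eta F n K)⁻¹ * ∑ ν : Fin 3, ((1 + Real.exp (-a)) * ((1 + 2 * (eta F n K)⁻¹ / (periodsT3 F K ν * Real.sqrt (m - 2 * (((3 : ℕ) : ℝ) - 1) * (eta F n K)⁻¹ ^ 2 * (Real.cosh a - 1)))) /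
            Real.sqrt ((m - 2 * (((3 : ℕ) : ℝ) - 1) * (eta F n K)⁻¹ ^ 2 * (Real.cosh a - 1)) ^ 2 + 4 * (m - 2 * (((3 : ℕ) : ℝ) - 1) * (eta F n K)⁻¹ ^ 2 * (Real.cosh a - 1)) * (eta F n K)⁻¹ ^ 2)) +
          2 * Real.sinh a / (m - 2 * ((3 : ℕ) : ℝ) * (eta F n K)⁻¹ ^ 2 * (Real.cosh a - 1))))
    (Tm : SiteL2K ℂ 3 (periodsT3 F K) c₀ W₂ →ₗ[ℂ] SiteL2K ℂ 3 (periodsT3 F K) c₀ W₂)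
    (hTm : Tm = covLaplaceSiteK (((eta F n K)⁻¹ : ℝ) : ℂ) (adBg F K V) (adBgInv F K V) + (m : ℂ) • LinearMap.id)
    (hpos : ∀ x : SiteL2K ℂ 3 (periodsT3 F K) c₀ W₂, x ≠ 0 → 0 < RCLike.re ⟪x, Tm x⟫_ℂ)
    (SH : ℝ) (hSH : 0 ≤ SH)
    (Hflat : ∀ (x₀ : TSite 3 (periodsT3 F K)) (u : SiteL2K ℂ 3 (periodsT3 F K) c₀ W₂) (f : BondL2K ℂ 3 (periodsT3 F K) c₀ W₂) (F' : ℝ), 0 ≤ F' →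
      covLaplaceSiteK (((eta F n K)⁻¹ : ℝ) : ℂ) (fun _ : Bond 3 (periodsT3 F K) => (LinearMap.id : W₂ →ₗ[ℂ] W₂)) (fun _ => LinearMap.id) u + (m : ℂ) • u =
        covDivL2K ℂ c₀ (((eta F n K)⁻¹ : ℝ) : ℂ) (fun _ : Bond 3 (periodsT3 F K) => (LinearMap.id : W₂ →ₗ[ℂ] W₂)) f →
      (∀ b, ‖WL2.equiv ℂ _ W₂ f b‖ ≤ F' * Wt x₀ (bpos b)) →
      ∀ x x', tdist (periodsT3 F K) x x' ≤ (F.L : ℝ) ^ (K - n) → ‖WL2.equiv ℂ _ W₂ u x' - WL2.equiv ℂ _ W₂ u x‖ ≤ SH * F' * (tdist (periodsT3 F K) x x' / (F.L : ℝ) ^ (K - n)) ^ ((1 : ℝ) / 2) * Wt x₀ x)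
    (Θg : ℝ) (hΘg : 0 ≤ Θg)
    (Hgrad : ∀ (x₀ : TSite 3 (periodsT3 F K)) (g : SiteL2K ℂ 3 (periodsT3 F K) c₀ W₂) (Gs : ℝ), 0 ≤ Gs → (∀ y, ‖WL2.equiv ℂ _ W₂ g y‖ ≤ Gs * Wt x₀ y) →
      ∀ b, ‖WL2.equiv ℂ _ W₂ (covDerivL2K ℂ c₀ (((eta F n K)⁻¹ : ℝ) : ℂ) (adBg F K V) (greenK Tm hpos g)) b‖ ≤ Θg * Gs * Wt x₀ (bpos b))
    (hκ : (eta F n K)⁻¹ * ε * Sad * (Real.exp a + 1) ≤ 1 / 2)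
    (x₀ : TSite 3 (periodsT3 F K)) (f : BondL2K ℂ 3 (periodsT3 F K) c₀ W₂) (F' : ℝ) (hF : 0 ≤ F') (hf : ∀ b, ‖WL2.equiv ℂ _ W₂ f b‖ ≤ F' * Wt x₀ (bpos b))
    (y y' : TSite 3 (periodsT3 F K)) (hyy : tdist (periodsT3 F K) y y' ≤ (F.L : ℝ) ^ (K - n)) :
    ‖WL2.equiv ℂ _ W₂ (greenK Tm hpos (covDivL2K ℂ c₀ (((eta F n K)⁻¹ : ℝ) : ℂ) (adBgInv F K V) f)) y'
        - WL2.equiv ℂ _ W₂ (greenK Tm hpos (covDivL2K ℂ c₀ (((eta F n K)⁻¹ : ℝ) : ℂ) (adBgInv F K V) f)) y‖ ≤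
      (2 * (SH + ((3 : ℕ) : ℝ) * (F.L : ℝ) ^ (K - n) * ((((eta F n K)⁻¹)⁻¹ * Θg + ε * (m - 2 * ((3 : ℕ) : ℝ) * (eta F n K)⁻¹ ^ 2 * (Real.cosh a - 1))⁻¹) * Real.exp (a * ((3 : ℕ) : ℝ) * ((F.L : ℝ) ^ (K - n) + 1))) * ((eta F n K)⁻¹ ^ 2 * ((3 : ℕ) : ℝ) * (ε ^ 2 * Real.exp a + ε') * Sad + (eta F n K)⁻¹ * ε * ((3 : ℕ) : ℝ) * Real.exp a))) * F' * (tdist (periodsT3 F K) y y' / (F.L : ℝ) ^ (K - n)) ^ ((1 : ℝ) / 2) * Wt x₀ y := by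
  have hL0 : (0 : ℝ) < F.L := by exact_mod_cast (lt_trans zero_lt_one F.hL.2)
  have hl : (0 : ℝ) < (F.L : ℝ) ^ (K - n) := pow_pos hL0 _
  exact holderAdjRow_covariantResolvent_half (P := periodsT3 F K) (c₀ := c₀) (W := W₂) (eta F n K)⁻¹ (inv_pos.2 (eta_pos F n K)) hm ha hε hε' hl
    (β := (1 : ℝ) / 2) (by norm_num) (by norm_num) hlam (two_le_periodsT3 F K) (adBg F K V) (adBgInv F K V) (adBgInv_adBg' V) (norm_adBg_le V) (norm_adBgInv_le V)
    hRε hSε hSε' Wt hWt Sad hSad Tm hTm hpos SH hSH Hflat Θg hΘg Hgrad hκ x₀ f F' hF hf y y' hyy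

/-- ★★ **THE VALUE ROW OF `w = (Δ^η_V + m)⁻¹D*_Vf` AT THE T³ MEMBER IN A REGULAR GAUGE** — lit ✓`B9Eq342CovariantResolventAdjointRow.adjRow_covariantResolvent_half` at the same letters
(NO flat∕gradient letter displayed: the flat value row is lit-PROVED): `‖w(y)‖ ≤ 2·(S_ad(1 + λ⁻¹t²d(ε²e^a + ε′)) + λ⁻¹tεde^a)·F·W_{x₀}(y)`, `λ = m − 2d t²(cosh a − 1)`, `t = η⁻¹`, `d = 3`.
[cite: Balaban1985BackgroundPropagators, Thm 3.1 (3.42) p.398, (3.23) p.394, (3.35) p.396] -/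
theorem valueRow_resolventCovDiv_member (V : GaugeField (F.P K) 0 (Matrix.specialUnitaryGroup (Fin 2) ℂ))
    {m a ε ε' : ℝ} (hm : 0 < m) (ha : 0 ≤ a) (hε : 0 ≤ ε) (hε' : 0 ≤ ε')
    (hlam : 2 * ((3 : ℕ) : ℝ) * (eta F n K)⁻¹ ^ 2 * (Real.cosh a - 1) < m)
    (hRε : ∀ (b : Bond 3 (periodsT3 F K)) (w : W₂), ‖adBg F K V b w - w‖ ≤ ε * ‖w‖)
    (hSε : ∀ (b : Bond 3 (periodsT3 F K)) (w : W₂), ‖adBgInv F K V b w - w‖ ≤ ε * ‖w‖)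
    (hSε' : ∀ (x : TSite 3 (periodsT3 F K)) (μ : Fin 3) (w : W₂), ‖adBgInv F K V (x, μ) w - adBgInv F K V (unshift μ x, μ) w‖ ≤ ε' * ‖w‖)
    (Wt : TSite 3 (periodsT3 F K) → TSite 3 (periodsT3 F K) → ℝ)
    (hWt : ∀ x₀ y, Wt x₀ y = ∏ μ, Real.cosh (a * (circAbs (periodsT3 F K μ) ((((x₀ μ : ℕ) : ZMod (periodsT3 F K μ)) - ((y μ : ℕ) : ZMod (periodsT3 F K μ))).val) : ℝ)))
    (Sad : ℝ)
    (hSad : Sad = (eta F n K)⁻¹ * ∑ ν : Fin 3, ((1 + Real.exp (-a)) * ((1 + 2 * (eta F n K)⁻¹ / (periodsT3 F K ν * Real.sqrt (m - 2 * (((3 : ℕ) : ℝ) - 1) * (eta F n K)⁻¹ ^ 2 * (Real.cosh a - 1)))) /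
            Real.sqrt ((m - 2 * (((3 : ℕ) : ℝ) - 1) * (eta F n K)⁻¹ ^ 2 * (Real.cosh a - 1)) ^ 2 + 4 * (m - 2 * (((3 : ℕ) : ℝ) - 1) * (eta F n K)⁻¹ ^ 2 * (Real.cosh a - 1)) * (eta F n K)⁻¹ ^ 2)) +
          2 * Real.sinh a / (m - 2 * ((3 : ℕ) : ℝ) * (eta F n K)⁻¹ ^ 2 * (Real.cosh a - 1))))
    (Tm : SiteL2K ℂ 3 (periodsT3 F K) c₀ W₂ →ₗ[ℂ] SiteL2K ℂ 3 (periodsT3 F K) c₀ W₂)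
    (hTm : Tm = covLaplaceSiteK (((eta F n K)⁻¹ : ℝ) : ℂ) (adBg F K V) (adBgInv F K V) + (m : ℂ) • LinearMap.id)
    (hpos : ∀ x : SiteL2K ℂ 3 (periodsT3 F K) c₀ W₂, x ≠ 0 → 0 < RCLike.re ⟪x, Tm x⟫_ℂ)
    (hκ : (eta F n K)⁻¹ * ε * Sad * (Real.exp a + 1) ≤ 1 / 2)
    (x₀ : TSite 3 (periodsT3 F K)) (f : BondL2K ℂ 3 (periodsT3 F K) c₀ W₂) (F' : ℝ) (hF : 0 ≤ F') (hf : ∀ b, ‖WL2.equiv ℂ _ W₂ f b‖ ≤ F' * Wt x₀ (bpos b))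
    (y : TSite 3 (periodsT3 F K)) :
    ‖WL2.equiv ℂ _ W₂ (greenK Tm hpos (covDivL2K ℂ c₀ (((eta F n K)⁻¹ : ℝ) : ℂ) (adBgInv F K V) f)) y‖ ≤
      (2 * (Sad * (1 + (m - 2 * ((3 : ℕ) : ℝ) * (eta F n K)⁻¹ ^ 2 * (Real.cosh a - 1))⁻¹ * ((eta F n K)⁻¹ ^ 2 * ((3 : ℕ) : ℝ) * (ε ^ 2 * Real.exp a + ε'))) + (m - 2 * ((3 : ℕ) : ℝ) * (eta F n K)⁻¹ ^ 2 * (Real.cosh a - 1))⁻¹ * ((eta F n K)⁻¹ * ε * ((3 : ℕ) : ℝ) * Real.exp a))) * F' * Wt x₀ y :=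
  adjRow_covariantResolvent_half (P := periodsT3 F K) (c₀ := c₀) (W := W₂) (eta F n K)⁻¹ (inv_pos.2 (eta_pos F n K)) hm ha hε hε' hlam (two_le_periodsT3 F K)
    (adBg F K V) (adBgInv F K V) (adBgInv_adBg' V) (norm_adBg_le V) (norm_adBgInv_le V) hRε hSε hSε' Wt hWt Sad hSad Tm hTm hpos hκ x₀ f F' hF hf y

/-! ## §3 Member notation: `Tm := Δ^η_V + m` (positivity discharged), `D*_V`, `D_V` -/

/-- **`Δ^η_V + m > 0` for `m > 0`**: `re⟪x, (Δ^η_V + m)x⟫ = ‖D_Vx‖² + m‖x‖² > 0` for `x ≠ 0` (✓`inner_covLapSite`) — lit's `hpos` at the member, discharged. [cite: Balaban1985BackgroundPropagators, (3.23) p.394] -/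
theorem covLapSite_add_pos (V : GaugeField (F.P K) 0 (Matrix.specialUnitaryGroup (Fin 2) ℂ)) {m : ℝ} (hm : 0 < m) :
    ∀ x : SiteL2K ℂ 3 (periodsT3 F K) c₀ W₂, x ≠ 0 →
      0 < RCLike.re ⟪x, (covLapSite F n K c₀ V + (m : ℂ) • (LinearMap.id : SiteL2K ℂ 3 (periodsT3 F K) c₀ W₂ →ₗ[ℂ] SiteL2K ℂ 3 (periodsT3 F K) c₀ W₂)) x⟫_ℂ := by
  intro x hx
  rw [LinearMap.add_apply, LinearMap.smul_apply, LinearMap.id_apply, inner_add_right, inner_smul_right, map_add]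
  have h1 : 0 ≤ RCLike.re ⟪x, covLapSite F n K c₀ V x⟫_ℂ := by
    rw [inner_covLapSite, ← Complex.ofReal_pow, RCLike.re_to_complex, Complex.ofReal_re]; positivity
  have hxx : (⟪x, x⟫_ℂ).re = ‖x‖ ^ 2 := by rw [← RCLike.re_to_complex]; exact inner_self_eq_norm_sq (𝕜 := ℂ) x
  have h2 : 0 < RCLike.re ((m : ℂ) * ⟪x, x⟫_ℂ) := by
    rw [RCLike.re_to_complex, Complex.re_ofReal_mul, hxx]
    have hx' : 0 < ‖x‖ := norm_pos_iff.2 hx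
    positivity
  exact add_pos_of_nonneg_of_pos h1 h2

/-- `Δ^η_V + m` in lit's letters (`t := η⁻¹` as a real cast). [cite: Balaban1985BackgroundPropagators, (3.23) p.394] -/
theorem covLapSite_add_eq (V : GaugeField (F.P K) 0 (Matrix.specialUnitaryGroup (Fin 2) ℂ)) (m : ℝ) :
    covLapSite F n K c₀ V + (m : ℂ) • LinearMap.id = covLaplaceSiteK (((eta F n K)⁻¹ : ℝ) : ℂ) (adBg F K V) (adBgInv F K V) + (m : ℂ) • LinearMap.id := by
  rw [covLapSite_eq, Complex.ofReal_inv]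

/-- `D*_V` in lit's letters. [cite: Balaban1985BackgroundPropagators, (3.8) p.392] -/
theorem DstarL2_eq_covDivL2K (V : GaugeField (F.P K) 0 (Matrix.specialUnitaryGroup (Fin 2) ℂ)) :
    DstarL2 F n K c₀ V = covDivL2K ℂ c₀ (((eta F n K)⁻¹ : ℝ) : ℂ) (adBgInv F K V) := by
  rw [Complex.ofReal_inv]; rfl

/-- `D_V` in lit's letters. [cite: Balaban1985BackgroundPropagators, (3.3) p.391] -/
theorem DL2_eq_covDerivL2K (V : GaugeField (F.P K) 0 (Matrix.specialUnitaryGroup (Fin 2) ℂ)) :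
    DL2 F n K c₀ V = covDerivL2K ℂ c₀ (((eta F n K)⁻¹ : ℝ) : ℂ) (adBg F K V) := by
  rw [Complex.ofReal_inv]; rfl

/-- ★★★ **THE η-½-HÖLDER ROW OF `w = (Δ^η_V + m)⁻¹D*_Vf`, MEMBER NOTATION** (`Tm := covLapSite V + m`, positivity discharged, `D*_V = DstarL2`, `D_V = DL2` in `Hgrad`): §2 with the two
`Complex.ofReal_inv` bridges.  This is the statement H2 FILE 2 (`ω₁ = R_S G′ᴾ_a D*_V x`) consumes. [cite: Balaban1985BackgroundPropagators, Thm 3.1 (3.43) p.398, (3.40) p.397, (3.23) p.394, (3.35) p.396] -/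
theorem holderRow_resolventDstarL2_member (V : GaugeField (F.P K) 0 (Matrix.specialUnitaryGroup (Fin 2) ℂ))
    {m a ε ε' : ℝ} (hm : 0 < m) (ha : 0 ≤ a) (hε : 0 ≤ ε) (hε' : 0 ≤ ε')
    (hlam : 2 * ((3 : ℕ) : ℝ) * (eta F n K)⁻¹ ^ 2 * (Real.cosh a - 1) < m)
    (hRε : ∀ (b : Bond 3 (periodsT3 F K)) (w : W₂), ‖adBg F K V b w - w‖ ≤ ε * ‖w‖)
    (hSε : ∀ (b : Bond 3 (periodsT3 F K)) (w : W₂), ‖adBgInv F K V b w - w‖ ≤ ε * ‖w‖)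
    (hSε' : ∀ (x : TSite 3 (periodsT3 F K)) (μ : Fin 3) (w : W₂), ‖adBgInv F K V (x, μ) w - adBgInv F K V (unshift μ x, μ) w‖ ≤ ε' * ‖w‖)
    (Wt : TSite 3 (periodsT3 F K) → TSite 3 (periodsT3 F K) → ℝ)
    (hWt : ∀ x₀ y, Wt x₀ y = ∏ μ, Real.cosh (a * (circAbs (periodsT3 F K μ) ((((x₀ μ : ℕ) : ZMod (periodsT3 F K μ)) - ((y μ : ℕ) : ZMod (periodsT3 F K μ))).val) : ℝ)))
    (Sad : ℝ)
    (hSad : Sad = (eta F n K)⁻¹ * ∑ ν : Fin 3, ((1 + Real.exp (-a)) * ((1 + 2 * (eta F n K)⁻¹ / (periodsT3 F K ν * Real.sqrt (m - 2 * (((3 : ℕ) : ℝ) - 1) * (eta F n K)⁻¹ ^ 2 * (Real.cosh a - 1)))) /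
            Real.sqrt ((m - 2 * (((3 : ℕ) : ℝ) - 1) * (eta F n K)⁻¹ ^ 2 * (Real.cosh a - 1)) ^ 2 + 4 * (m - 2 * (((3 : ℕ) : ℝ) - 1) * (eta F n K)⁻¹ ^ 2 * (Real.cosh a - 1)) * (eta F n K)⁻¹ ^ 2)) +
          2 * Real.sinh a / (m - 2 * ((3 : ℕ) : ℝ) * (eta F n K)⁻¹ ^ 2 * (Real.cosh a - 1))))
    (SH : ℝ) (hSH : 0 ≤ SH)
    (Hflat : ∀ (x₀ : TSite 3 (periodsT3 F K)) (u : SiteL2K ℂ 3 (periodsT3 F K) c₀ W₂) (f : BondL2K ℂ 3 (periodsT3 F K) c₀ W₂) (F' : ℝ), 0 ≤ F' →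
      covLaplaceSiteK (((eta F n K)⁻¹ : ℝ) : ℂ) (fun _ : Bond 3 (periodsT3 F K) => (LinearMap.id : W₂ →ₗ[ℂ] W₂)) (fun _ => LinearMap.id) u + (m : ℂ) • u =
        covDivL2K ℂ c₀ (((eta F n K)⁻¹ : ℝ) : ℂ) (fun _ : Bond 3 (periodsT3 F K) => (LinearMap.id : W₂ →ₗ[ℂ] W₂)) f →
      (∀ b, ‖WL2.equiv ℂ _ W₂ f b‖ ≤ F' * Wt x₀ (bpos b)) →
      ∀ x x', tdist (periodsT3 F K) x x' ≤ (F.L : ℝ) ^ (K - n) → ‖WL2.equiv ℂ _ W₂ u x' - WL2.equiv ℂ _ W₂ u x‖ ≤ SH * F' * (tdist (periodsT3 F K) x x' / (F.L : ℝ) ^ (K - n)) ^ ((1 : ℝ) / 2) * Wt x₀ x)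
    (Θg : ℝ) (hΘg : 0 ≤ Θg)
    (Hgrad : ∀ (x₀ : TSite 3 (periodsT3 F K)) (g : SiteL2K ℂ 3 (periodsT3 F K) c₀ W₂) (Gs : ℝ), 0 ≤ Gs → (∀ y, ‖WL2.equiv ℂ _ W₂ g y‖ ≤ Gs * Wt x₀ y) →
      ∀ b, ‖WL2.equiv ℂ _ W₂ (DL2 F n K c₀ V (greenK (covLapSite F n K c₀ V + (m : ℂ) • LinearMap.id) (covLapSite_add_pos F n K c₀ V hm) g)) b‖ ≤ Θg * Gs * Wt x₀ (bpos b))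
    (hκ : (eta F n K)⁻¹ * ε * Sad * (Real.exp a + 1) ≤ 1 / 2)
    (x₀ : TSite 3 (periodsT3 F K)) (f : BondL2K ℂ 3 (periodsT3 F K) c₀ W₂) (F' : ℝ) (hF : 0 ≤ F') (hf : ∀ b, ‖WL2.equiv ℂ _ W₂ f b‖ ≤ F' * Wt x₀ (bpos b))
    (y y' : TSite 3 (periodsT3 F K)) (hyy : tdist (periodsT3 F K) y y' ≤ (F.L : ℝ) ^ (K - n)) :
    ‖WL2.equiv ℂ _ W₂ (greenK (covLapSite F n K c₀ V + (m : ℂ) • LinearMap.id) (covLapSite_add_pos F n K c₀ V hm) (DstarL2 F n K c₀ V f)) y'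
        - WL2.equiv ℂ _ W₂ (greenK (covLapSite F n K c₀ V + (m : ℂ) • LinearMap.id) (covLapSite_add_pos F n K c₀ V hm) (DstarL2 F n K c₀ V f)) y‖ ≤
      (2 * (SH + ((3 : ℕ) : ℝ) * (F.L : ℝ) ^ (K - n) * ((((eta F n K)⁻¹)⁻¹ * Θg + ε * (m - 2 * ((3 : ℕ) : ℝ) * (eta F n K)⁻¹ ^ 2 * (Real.cosh a - 1))⁻¹) * Real.exp (a * ((3 : ℕ) : ℝ) * ((F.L : ℝ) ^ (K - n) + 1))) * ((eta F n K)⁻¹ ^ 2 * ((3 : ℕ) : ℝ) * (ε ^ 2 * Real.exp a + ε') * Sad + (eta F n K)⁻¹ * ε * ((3 : ℕ) : ℝ) * Real.exp a))) * F' * (tdist (periodsT3 F K) y y' / (F.L : ℝ) ^ (K - n)) ^ ((1 : ℝ) / 2) * Wt x₀ y := by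
  rw [DstarL2_eq_covDivL2K]
  have Hgrad' : ∀ (x₀ : TSite 3 (periodsT3 F K)) (g : SiteL2K ℂ 3 (periodsT3 F K) c₀ W₂) (Gs : ℝ), 0 ≤ Gs → (∀ y, ‖WL2.equiv ℂ _ W₂ g y‖ ≤ Gs * Wt x₀ y) →
      ∀ b, ‖WL2.equiv ℂ _ W₂ (covDerivL2K ℂ c₀ (((eta F n K)⁻¹ : ℝ) : ℂ) (adBg F K V)
        (greenK (covLapSite F n K c₀ V + (m : ℂ) • LinearMap.id) (covLapSite_add_pos F n K c₀ V hm) g)) b‖ ≤ Θg * Gs * Wt x₀ (bpos b) := by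
    rw [← DL2_eq_covDerivL2K]; exact Hgrad
  exact holderRow_resolventCovDiv_member F n K c₀ V hm ha hε hε' hlam hRε hSε hSε' Wt hWt Sad hSad _ (covLapSite_add_eq F n K c₀ V m) (covLapSite_add_pos F n K c₀ V hm)
    SH hSH Hflat Θg hΘg Hgrad' hκ x₀ f F' hF hf y y' hyy

/-! ## §4 Letter (A) (window `ℓ`) ⟹ the ball-restricted plain modulus `hH` of ✓∕⧗`Prop7AxialHolderLetterGlue.hHω_of_plain_of_transporter` -/

omit [Fact (0 < c₀)] in
/-- **WINDOW ⟹ BALLS**: a plain η-½-Hölder modulus on the window `tdist y y′ ≤ ℓ` (letter (A), `ℓ = L^(K−n)`) together with the sup row `‖ω‖ ≤ N_ω` gives the plain modulus for ALL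
pairs, in particular on px13's balls, with constant `H_A + 2N_ω` (for `tdist > ℓ` the factor `(tdist∕ℓ)^{½} ≥ 1` absorbs `2N_ω`).  The ball premises are not used. [folklore] -/
theorem plainModulus_ball_of_window (ω : SiteL2K ℂ 3 (periodsT3 F K) c₀ W₂) {Nω HA : ℝ} (hN0 : 0 ≤ Nω) (hA0 : 0 ≤ HA)
    (hN : ∀ y : TSite 3 (periodsT3 F K), ‖WL2.equiv ℂ (fun _ : TSite 3 (periodsT3 F K) => c₀) W₂ ω y‖ ≤ Nω)
    (hHωA : ∀ (y y' : TSite 3 (periodsT3 F K)), tdist (periodsT3 F K) y y' ≤ (F.L : ℝ) ^ (K - n) →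
      ‖WL2.equiv ℂ (fun _ : TSite 3 (periodsT3 F K) => c₀) W₂ ω y' - WL2.equiv ℂ (fun _ : TSite 3 (periodsT3 F K) => c₀) W₂ ω y‖
        ≤ HA * (tdist (periodsT3 F K) y y' / ((F.L : ℝ) ^ (K - n))) ^ ((1 : ℝ) / 2))
    (R : ℝ) (x₀ : TSite 3 (periodsT3 F K)) :
    ∀ (y y' : TSite 3 (periodsT3 F K)), tdist (periodsT3 F K) x₀ y ≤ R → tdist (periodsT3 F K) x₀ y' ≤ R →
      ‖WL2.equiv ℂ (fun _ : TSite 3 (periodsT3 F K) => c₀) W₂ ω y' - WL2.equiv ℂ (fun _ : TSite 3 (periodsT3 F K) => c₀) W₂ ω y‖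
        ≤ (HA + 2 * Nω) * (tdist (periodsT3 F K) y y' / ((F.L : ℝ) ^ (K - n))) ^ ((1 : ℝ) / 2) := by
  intro y y' _ _
  have hL0 : (0 : ℝ) < F.L := by exact_mod_cast (lt_trans zero_lt_one F.hL.2)
  have hl : (0 : ℝ) < (F.L : ℝ) ^ (K - n) := pow_pos hL0 _
  have hr0 : 0 ≤ (tdist (periodsT3 F K) y y' / ((F.L : ℝ) ^ (K - n))) ^ ((1 : ℝ) / 2) :=
    Real.rpow_nonneg (div_nonneg (tdist_nonneg _ _ _) hl.le) _
  by_cases hd : tdist (periodsT3 F K) y y' ≤ (F.L : ℝ) ^ (K - n)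
  · calc _ ≤ HA * (tdist (periodsT3 F K) y y' / ((F.L : ℝ) ^ (K - n))) ^ ((1 : ℝ) / 2) := hHωA y y' hd
      _ ≤ (HA + 2 * Nω) * (tdist (periodsT3 F K) y y' / ((F.L : ℝ) ^ (K - n))) ^ ((1 : ℝ) / 2) := by
          apply mul_le_mul_of_nonneg_right _ hr0; linarith
  · have hr1 : 1 ≤ (tdist (periodsT3 F K) y y' / ((F.L : ℝ) ^ (K - n))) ^ ((1 : ℝ) / 2) :=
      Real.one_le_rpow ((one_le_div hl).2 (le_of_lt (not_le.1 hd))) (by norm_num)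
    calc _ ≤ ‖WL2.equiv ℂ (fun _ : TSite 3 (periodsT3 F K) => c₀) W₂ ω y'‖ + ‖WL2.equiv ℂ (fun _ : TSite 3 (periodsT3 F K) => c₀) W₂ ω y‖ := norm_sub_le _ _
      _ ≤ Nω + Nω := add_le_add (hN y') (hN y)
      _ = (2 * Nω) * 1 := by ring
      _ ≤ (HA + 2 * Nω) * (tdist (periodsT3 F K) y y' / ((F.L : ℝ) ^ (K - n))) ^ ((1 : ℝ) / 2) :=
          mul_le_mul (by linarith) hr1 zero_le_one (by linarith)

omit [Fact (0 < c₀)] in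
/-- **`hH_of_window_of_sup`** (★★OWNER g36 15:45:58Z ruling, №48 (3) follow-through): letter (A) `hHωA` (window `ℓ`) and the sup row `hN` ⟹ the `hH` premise of
✓∕⧗`Prop7AxialHolderLetterGlue.hHω_of_plain_of_transporter` VERBATIM (ball-local, unwindowed; ws-sha16 f43aa461 of px13's text) with `H := Hω + 2·Nω`. [folklore] -/
theorem hH_of_window_of_sup (ω : SiteL2K ℂ 3 (periodsT3 F K) c₀ W₂) {Nω Hω : ℝ} (hN0 : 0 ≤ Nω) (hH0 : 0 ≤ Hω)
    (hHωA : ∀ (y y' : TSite 3 (periodsT3 F K)), tdist (periodsT3 F K) y y' ≤ (F.L : ℝ) ^ (K - n) →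
      ‖WL2.equiv ℂ (fun _ : TSite 3 (periodsT3 F K) => c₀) W₂ ω y' - WL2.equiv ℂ (fun _ : TSite 3 (periodsT3 F K) => c₀) W₂ ω y‖
        ≤ Hω * (tdist (periodsT3 F K) y y' / ((F.L : ℝ) ^ (K - n))) ^ ((1 : ℝ) / 2))
    (hN : ∀ y : TSite 3 (periodsT3 F K), ‖WL2.equiv ℂ (fun _ : TSite 3 (periodsT3 F K) => c₀) W₂ ω y‖ ≤ Nω) :
    ∀ (c : Site (F.P K) 0) (y y' : TSite 3 (periodsT3 F K)),
      tdist (periodsT3 F K) (siteEquiv F K c) y ≤ 4 * (F.L : ℝ) ^ (K - n) + 1 → tdist (periodsT3 F K) (siteEquiv F K c) y' ≤ 4 * (F.L : ℝ) ^ (K - n) + 1 →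
      ‖WL2.equiv ℂ (fun _ : TSite 3 (periodsT3 F K) => c₀) W₂ ω y' - WL2.equiv ℂ (fun _ : TSite 3 (periodsT3 F K) => c₀) W₂ ω y‖
        ≤ (Hω + 2 * Nω) * (tdist (periodsT3 F K) y y' / ((F.L : ℝ) ^ (K - n))) ^ ((1 : ℝ) / 2) :=
  fun c y y' hy hy' => plainModulus_ball_of_window F n K c₀ ω hN0 hH0 hN hHωA (4 * (F.L : ℝ) ^ (K - n) + 1) (siteEquiv F K c) y y' hy hy'

/-! ## §5 The unweighted edition (`a := 0`, `W ≡ 1`): sup-bounded data, plain differences — letter (A)'s shape with the fewest letters -/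

/-- ★★★ **THE UNWEIGHTED η-½-HÖLDER ROW OF `w = (Δ^η_V + m)⁻¹D*_Vf` AT THE MEMBER** (§3 at weight scale `a := 0`, `W_{x₀} ≡ 1`, so `hlam` is void and the data row is a plain sup
bound `‖f(b)‖ ≤ F`): for `tdist y y′ ≤ L^(K−n)`, `‖w(y′) − w(y)‖ ≤ 2A_H⁰·F·(tdist∕L^(K−n))^{½}` with `A_H⁰` = lit's `A_H` at `a = 0` (written with `cosh 0`, `exp 0`, `sinh 0` in
place — pure instantiation).  Displayed: the regular-gauge rows, `Sad⁰` (pinned), the UNWEIGHTED flat two-point letter `Hflat⁰` and gradient letter `Hgrad⁰`, the window `hκ`.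
[cite: Balaban1985BackgroundPropagators, Thm 3.1 (3.43) p.398, (3.40) p.397, (3.35) p.396] -/
theorem holderRow_resolventDstarL2_unweighted (V : GaugeField (F.P K) 0 (Matrix.specialUnitaryGroup (Fin 2) ℂ))
    {m ε ε' : ℝ} (hm : 0 < m) (hε : 0 ≤ ε) (hε' : 0 ≤ ε')
    (hRε : ∀ (b : Bond 3 (periodsT3 F K)) (w : W₂), ‖adBg F K V b w - w‖ ≤ ε * ‖w‖)
    (hSε : ∀ (b : Bond 3 (periodsT3 F K)) (w : W₂), ‖adBgInv F K V b w - w‖ ≤ ε * ‖w‖)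
    (hSε' : ∀ (x : TSite 3 (periodsT3 F K)) (μ : Fin 3) (w : W₂), ‖adBgInv F K V (x, μ) w - adBgInv F K V (unshift μ x, μ) w‖ ≤ ε' * ‖w‖)
    (Sad : ℝ)
    (hSad : Sad = (eta F n K)⁻¹ * ∑ ν : Fin 3, ((1 + Real.exp (-0)) * ((1 + 2 * (eta F n K)⁻¹ / (periodsT3 F K ν * Real.sqrt (m - 2 * (((3 : ℕ) : ℝ) - 1) * (eta F n K)⁻¹ ^ 2 * (Real.cosh 0 - 1)))) /
            Real.sqrt ((m - 2 * (((3 : ℕ) : ℝ) - 1) * (eta F n K)⁻¹ ^ 2 * (Real.cosh 0 - 1)) ^ 2 + 4 * (m - 2 * (((3 : ℕ) : ℝ) - 1) * (eta F n K)⁻¹ ^ 2 * (Real.cosh 0 - 1)) * (eta F n K)⁻¹ ^ 2)) +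
          2 * Real.sinh 0 / (m - 2 * ((3 : ℕ) : ℝ) * (eta F n K)⁻¹ ^ 2 * (Real.cosh 0 - 1))))
    (SH : ℝ) (hSH : 0 ≤ SH)
    (Hflat : ∀ (u : SiteL2K ℂ 3 (periodsT3 F K) c₀ W₂) (f : BondL2K ℂ 3 (periodsT3 F K) c₀ W₂) (F' : ℝ), 0 ≤ F' →
      covLaplaceSiteK (((eta F n K)⁻¹ : ℝ) : ℂ) (fun _ : Bond 3 (periodsT3 F K) => (LinearMap.id : W₂ →ₗ[ℂ] W₂)) (fun _ => LinearMap.id) u + (m : ℂ) • u =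
        covDivL2K ℂ c₀ (((eta F n K)⁻¹ : ℝ) : ℂ) (fun _ : Bond 3 (periodsT3 F K) => (LinearMap.id : W₂ →ₗ[ℂ] W₂)) f →
      (∀ b, ‖WL2.equiv ℂ _ W₂ f b‖ ≤ F') →
      ∀ x x', tdist (periodsT3 F K) x x' ≤ (F.L : ℝ) ^ (K - n) → ‖WL2.equiv ℂ _ W₂ u x' - WL2.equiv ℂ _ W₂ u x‖ ≤ SH * F' * (tdist (periodsT3 F K) x x' / (F.L : ℝ) ^ (K - n)) ^ ((1 : ℝ) / 2))
    (Θg : ℝ) (hΘg : 0 ≤ Θg)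
    (Hgrad : ∀ (g : SiteL2K ℂ 3 (periodsT3 F K) c₀ W₂) (Gs : ℝ), 0 ≤ Gs → (∀ y, ‖WL2.equiv ℂ _ W₂ g y‖ ≤ Gs) →
      ∀ b, ‖WL2.equiv ℂ _ W₂ (DL2 F n K c₀ V (greenK (covLapSite F n K c₀ V + (m : ℂ) • LinearMap.id) (covLapSite_add_pos F n K c₀ V hm) g)) b‖ ≤ Θg * Gs)
    (hκ : (eta F n K)⁻¹ * ε * Sad * (Real.exp 0 + 1) ≤ 1 / 2)
    (f : BondL2K ℂ 3 (periodsT3 F K) c₀ W₂) (F' : ℝ) (hF : 0 ≤ F') (hf : ∀ b, ‖WL2.equiv ℂ _ W₂ f b‖ ≤ F')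
    (y y' : TSite 3 (periodsT3 F K)) (hyy : tdist (periodsT3 F K) y y' ≤ (F.L : ℝ) ^ (K - n)) :
    ‖WL2.equiv ℂ _ W₂ (greenK (covLapSite F n K c₀ V + (m : ℂ) • LinearMap.id) (covLapSite_add_pos F n K c₀ V hm) (DstarL2 F n K c₀ V f)) y'
        - WL2.equiv ℂ _ W₂ (greenK (covLapSite F n K c₀ V + (m : ℂ) • LinearMap.id) (covLapSite_add_pos F n K c₀ V hm) (DstarL2 F n K c₀ V f)) y‖ ≤
      (2 * (SH + ((3 : ℕ) : ℝ) * (F.L : ℝ) ^ (K - n) * ((((eta F n K)⁻¹)⁻¹ * Θg + ε * (m - 2 * ((3 : ℕ) : ℝ) * (eta F n K)⁻¹ ^ 2 * (Real.cosh 0 - 1))⁻¹) * Real.exp (0 * ((3 : ℕ) : ℝ) * ((F.L : ℝ) ^ (K - n) + 1))) * ((eta F n K)⁻¹ ^ 2 * ((3 : ℕ) : ℝ) * (ε ^ 2 * Real.exp 0 + ε') * Sad + (eta F n K)⁻¹ * ε * ((3 : ℕ) : ℝ) * Real.exp 0))) * F' * (tdist (periodsT3 F K) y y' / (F.L : ℝ)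 ^ (K - n)) ^ ((1 : ℝ) / 2) * (1 : ℝ) := by
  have hW : ∀ x₀ y₁ : TSite 3 (periodsT3 F K), (1 : ℝ) = ∏ μ : Fin 3, Real.cosh ((0 : ℝ) * (circAbs (periodsT3 F K μ) ((((x₀ μ : ℕ) : ZMod (periodsT3 F K μ)) - ((y₁ μ : ℕ) : ZMod (periodsT3 F K μ))).val) : ℝ)) := by
    intro x₀ y₁; simp only [zero_mul, Real.cosh_zero, Finset.prod_const_one]
  have hlam : 2 * ((3 : ℕ) : ℝ) * (eta F n K)⁻¹ ^ 2 * (Real.cosh 0 - 1) < m := by rw [Real.cosh_zero, sub_self, mul_zero]; exact hm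
  have h := holderRow_resolventDstarL2_member F n K c₀ V (a := 0) hm le_rfl hε hε' hlam hRε hSε hSε' (fun _ _ => (1 : ℝ)) hW Sad hSad SH hSH
    (fun x₀ u f' F'' hF'' heq hf' x x' hxx => by
      have h1 := Hflat u f' F'' hF'' heq (fun b => by simpa only [mul_one] using hf' b) x x' hxx
      simpa only [mul_one] using h1)
    Θg hΘg
    (fun x₀ g Gs hGs hg b => by
      have h1 := Hgrad g Gs hGs (fun y₁ => by simpa only [mul_one] using hg y₁) b
      simpa only [mul_one] using h1)
    hκ y f F' hF (fun b => by simpa only [mul_one] using hf b) y y' hyy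
  exact h

end Row

end Summit.QuantumFields.YangMills.Theorems.Prop7ResolventHolderRowMember

end
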